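import Literature.Computability.Complexity.PostBPPHashLanguage
import Literature.Computability.Complexity.PromiseBPPAmplification
import Literature.Computability.Complexity.ProbabilisticClassesProofs
import Literature.Computability.Complexity.NPClosureProofs
import HarnessLib

/-!
# The Sipser–Gács theorem `BPP ⊆ Σ₂ᵖ ∩ Π₂ᵖ` (Sipser 1983; Lautemann 1983)

Topic `Computability/Complexity`. Sipser, *A complexity theoretic approach to randomness* (STOC
1983), §V, shows that `BPP` lies in the polynomial-time hierarchy and records Gács's improvement
`BPP ⊆ Σ₂ᵖ ∩ Π₂ᵖ` (the *Sipser–Gács theorem*; Lautemann 1983 gave the shift proof reproduced in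
Arora–Barak 2009, Thm. 7.15). This file PROVES the theorem over the tree's classes
(`BPP = bp P`, `SigmaP`, `PiP` of `ProbabilisticClasses.lean` / `PolyHierarchy.lean`):

* `sipser_gacs_lautemann : BPP ⊆ SigmaP 2 ∩ PiP 2`, from `BPP_subset_SigmaP_two` and
  `BPP_subset_PiP_two` (the latter by `co BPP = BPP`, `co_BPP_holds`).

It discharges the named fact
`Literature.Computability.QuantumComplexity.BPP_subset_SigmaP_two_inter_PiP_two`
(`QuantumComplexity/ClassicalClasses.lean`; discharge in `QuantumComplexity/ClassicalClassesProofs.lean`).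

## The proof (Sipser's hashing argument, assembled from the tree)

Sipser's own route (§III Coding Lemma + §V), not Lautemann's shifts, because every ingredient is
already a proved theorem of the tree:

1. **Amplification** (`PromiseBPPAmplification.lean`): for `L ∈ BPP` with witness `L' ∈ P` and coin
   polynomial `p`, the majority-vote language `A = PromiseAmp.ampLang L' p 3 ∈ P` with coin
   polynomial `q = PromiseAmp.coins p 3` (`m = q(n) = 73 p(n) + 74` coins) errs on at most a
   quarter of the coin strings on either side (`uniformProb_ampLang_compl_le`,
   `uniformProb_ampLang_le`, Chebyshev form with `r = 3`).
2. **Small vs. large** (`SipserGacs.mem_iff_hashable`): with `rej(x) ⊆ {0,1}^m` the rejecting coin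
   vectors of `A` (`PostBPPHash.rejSet ⊤ A x m`), `t = m + 5` (`PostBPPHash.runs`) and the product
   `X = rej(x)^t` (`PostBPPHash.tuplePow`, `|X| = |rej(x)|^t`): if `x ∈ L` then `4|rej(x)| ≤ 2^m`,
   so `2|X| ≤ 2^k` for `k = t(m-1)` and `X` is hashable by `k` linear maps (Sipser's Coding Lemma,
   `SipserHash.hashable_of_card_le`); if `x ∉ L` then `4|rej(x)| ≥ 3·2^m`, so `|X| > k·2^k`
   (`2^t t² < 3^t` for `t ≥ 13`) and `X` is not hashable (pigeonhole, `SipserHash.card_le_of_hashable`).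
   Hence `x ∈ L ↔ Hash_X(k)`.
3. **`Hash` is `Σ₂ᵖ`** (`PostBPPHashLanguage.lean`, HHT 1997 Thm. 3.11 after Sipser):
   `PostBPPHash.Hash ⊤ A q ∈ SigmaP 2` and `⟨x, 1^{2k+1}⟩ ∈ Hash ↔ Hash_{rej(x)^t}(k)`
   (`mem_Hash_iff_rej`); the query map `x ↦ ⟨x, 1^{2k(|x|)+1}⟩` is in `FP` (`pairFn`, `padFn`,
   `k(n) = (73 p(n) + 79)(73 p(n) + 73)` a polynomial), and `Σ₂ᵖ` is closed under polynomial-time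
   preimages (`preimage_mem_SigmaP`). So `L ∈ Σ₂ᵖ`; `Π₂ᵖ` follows from `co BPP = BPP`.

No new definitions and no named facts are introduced (D-0026); the parameters are written out.

## References

* M. Sipser, *A complexity theoretic approach to randomness*, Proc. 15th STOC (1983) 330–335,
  §III (Coding Lemma) and §V (`BPP ⊆ Σ₂ᵖ ∩ Π₂ᵖ`, with P. Gács) [Sipser1983] (held:
  `paper:doi-10-1145-800061-808762`).
* C. Lautemann, *BPP and the polynomial hierarchy*, Inform. Process. Lett. 17 (1983) 215–217.
* S. Arora, B. Barak, *Computational Complexity: A Modern Approach*, CUP 2009, Thm. 7.15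
  (`BPP ⊆ Σ₂ᵖ ∩ Π₂ᵖ`), §7.4.1 (error reduction) [AroraBarakCC2009].
* Y. Han, L. A. Hemaspaandra, T. Thierauf, *Threshold computation and cryptographic security*,
  SIAM J. Comput. 26 (1997) 59–78, Def. 3.8 and Thm. 3.11 (the `Σ₂ᵖ` predicate `Hash`)
  [HanHemaspaandraThierauf1997].
-/

namespace Literature.Computability.Complexity

open _root_.Computability Polynomial Finset OracleCompose PostBPPHash SipserHash PromiseAmp

namespace SipserGacs

/-! ### Arithmetic -/

/-- `2^t · t² < 3^t` for `t ≥ 13` (the exponential gap beating the pigeonhole factor `k` of the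
Coding Lemma). [folklore] -/
theorem two_pow_mul_sq_lt_three_pow {t : ℕ} (ht : 13 ≤ t) : 2 ^ t * t ^ 2 < 3 ^ t := by
  induction t, ht using Nat.le_induction with
  | base => norm_num
  | succ t ht ih =>
    have h1 : 2 * (t + 1) ^ 2 ≤ 3 * t ^ 2 := by nlinarith
    calc 2 ^ (t + 1) * (t + 1) ^ 2 = 2 ^ t * (2 * (t + 1) ^ 2) := by ring
      _ ≤ 2 ^ t * (3 * t ^ 2) := Nat.mul_le_mul_left _ h1
      _ = 3 * (2 ^ t * t ^ 2) := by ring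
      _ < 3 * 3 ^ t := Nat.mul_lt_mul_of_pos_left ih (by norm_num)
      _ = 3 ^ (t + 1) := by ring

/-- A probability `≤ 1/4` in counting form: `4 · cnt ≤ 2^m`. [folklore] -/
theorem four_mul_cnt_le {m : ℕ} {E : Set (List Bool)} (h : uniformProb m E ≤ 1 / 4) :
    4 * cnt m E ≤ 2 ^ m := by
  rw [uniformProb_eq_cnt_div, div_le_iff₀ (by positivity)] at h
  have h' : ((4 * cnt m E : ℕ) : ℝ) ≤ ((2 ^ m : ℕ) : ℝ) := by push_cast; linarith
  exact_mod_cast h'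

/-! ### The Coding-Lemma criterion: small sets are hashable, large sets are not -/

/-- **Small side.** If `4|X| ≤ 2^m` (`m ≥ 1`, `t ≥ 1`) then the product `X^t ⊆ {0,1}^{tm}` is
hashable by `k = t(m-1)` matrices: `2|X^t| = 2|X|^t ≤ 2·2^{t(m-2)} ≤ 2^k` and Sipser's Coding
Lemma applies. [cite: Sipser1983, §III (Coding Lemma)] -/
theorem hashable_tuplePow_of_small {m t : ℕ} (hm : 1 ≤ m) (ht : 1 ≤ t) {X : Finset (Fin m → Bool)}
    (h : 4 * X.card ≤ 2 ^ m) : Hashable (tuplePow X t) (t * (m - 1)) := by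
  apply hashable_of_card_le
  rw [card_tuplePow]
  have h1 : (4 * X.card) ^ t ≤ (2 ^ m) ^ t := Nat.pow_le_pow_left h t
  have h2 : 2 ≤ 2 ^ t := by
    calc (2 : ℕ) = 2 ^ 1 := by norm_num
      _ ≤ 2 ^ t := Nat.pow_le_pow_right (by norm_num) ht
  have hexp : 2 * t + t * (m - 1) = m * t + t := by zify [hm]; ring
  have key : 4 ^ t * (2 * X.card ^ t) ≤ 4 ^ t * 2 ^ (t * (m - 1)) := by
    calc 4 ^ t * (2 * X.card ^ t) = 2 * (4 * X.card) ^ t := by rw [mul_pow]; ring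
      _ ≤ 2 * (2 ^ m) ^ t := Nat.mul_le_mul_left 2 h1
      _ ≤ 2 ^ t * (2 ^ m) ^ t := Nat.mul_le_mul_right _ h2
      _ = 2 ^ (m * t + t) := by rw [← pow_mul, ← pow_add, add_comm]
      _ = 4 ^ t * 2 ^ (t * (m - 1)) := by
        rw [show (4 : ℕ) = 2 ^ 2 by norm_num, ← pow_mul, ← pow_add, hexp]
  exact Nat.le_of_mul_le_mul_left key (by positivity)

/-- **Large side.** If `4|X| ≥ 3·2^m` (`1 ≤ m ≤ t`, `t ≥ 13`) then `X^t` is NOT hashable by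
`k = t(m-1)` matrices: a hashable set has at most `k·2^k` members (pigeonhole), but
`|X^t| ≥ (3/4)^t 2^{tm} > t²·2^{t(m-1)} ≥ k·2^k` since `2^t t² < 3^t`. [cite: Sipser1983, §III (Coding Lemma)] -/
theorem not_hashable_tuplePow_of_large {m t : ℕ} (hm : 1 ≤ m) (hmt : m ≤ t) (ht : 13 ≤ t)
    {X : Finset (Fin m → Bool)} (h : 3 * 2 ^ m ≤ 4 * X.card) :
    ¬ Hashable (tuplePow X t) (t * (m - 1)) := by
  intro hH
  have hc := card_le_of_hashable hH
  rw [card_tuplePow] at hc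
  have h1 : (3 * 2 ^ m) ^ t ≤ (4 * X.card) ^ t := Nat.pow_le_pow_left h t
  have hexp : 2 * t + t * (m - 1) = m * t + t := by zify [hm]; ring
  have hkm : t * (m - 1) ≤ t * t := Nat.mul_le_mul_left t (by omega)
  have h3 : 3 ^ t * 2 ^ (m * t) ≤ (t * t * 2 ^ t) * 2 ^ (m * t) := by
    calc 3 ^ t * 2 ^ (m * t) = (3 * 2 ^ m) ^ t := by rw [mul_pow, ← pow_mul]
      _ ≤ (4 * X.card) ^ t := h1
      _ = 4 ^ t * X.card ^ t := by rw [mul_pow]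
      _ ≤ 4 ^ t * (t * (m - 1) * 2 ^ (t * (m - 1))) := Nat.mul_le_mul_left _ hc
      _ = t * (m - 1) * (4 ^ t * 2 ^ (t * (m - 1))) := by ring
      _ = t * (m - 1) * 2 ^ (m * t + t) := by
        rw [show (4 : ℕ) = 2 ^ 2 by norm_num, ← pow_mul, ← pow_add, hexp]
      _ ≤ t * t * 2 ^ (m * t + t) := Nat.mul_le_mul_right _ hkm
      _ = (t * t * 2 ^ t) * 2 ^ (m * t) := by rw [pow_add]; ring
  have h4 : 3 ^ t ≤ t * t * 2 ^ t := Nat.le_of_mul_le_mul_right h3 (by positivity)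
  have h5 := two_pow_mul_sq_lt_three_pow ht
  have h6 : t * t * 2 ^ t = 2 ^ t * t ^ 2 := by ring
  rw [h6] at h4
  exact absurd (lt_of_lt_of_le h5 h4) (lt_irrefl _)

/-! ### The criterion for an amplified `BPP` language -/

/-- `⊤ ∈ P` (the always-true post-selection predicate). [folklore] -/
theorem top_mem_P' {A : Language Bool} (hA : A ∈ Classes.P) : (⊤ : Language Bool) ∈ Classes.P := by
  have h := union_mem_P hA (compl_mem_P_iff.2 hA)
  rwa [sup_compl_eq_top] at h

/-- The rejecting coin vectors of `A` under the trivial post-selection `⊤` are counted by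
`cnt m {y | ⟨x, y⟩ ∉ A}`. [folklore] -/
theorem card_rejSet_top (A : Language Bool) (x : List Bool) (m : ℕ) :
    (rejSet ⊤ A x m).card = cnt m {y | boolPair x y ∉ A} := by
  rw [card_rejSet]
  exact cnt_congr fun y _ => ⟨fun hy => hy.2, fun hy => ⟨trivial, hy⟩⟩

/-- The coin polynomial of the amplified witness: `q(n) = 73 p(n) + 74`. [folklore] -/
theorem coins_three_eval (p : Polynomial ℕ) (n : ℕ) : (coins p 3).eval n = 73 * p.eval n + 74 := by
  have h3 : (3 : Polynomial ℕ).eval n = 3 := by simp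
  have h := coins_eval p 3 n
  rw [h3] at h
  omega

/-- **The criterion** (Sipser 1983, §V, for the amplified machine). Let `L ∈ BPP` be witnessed by
`L' ∈ P` with coin polynomial `p`, let `A = ampLang L' p 3` (error `≤ 1/4`, `m = 73 p(n) + 74`
coins), `t = m + 5`, `k = t(m-1)`. Then `x ∈ L` iff the `t`-fold product of the rejecting coin
vectors of `A` on `x` is hashable by `k` matrices. [cite: Sipser1983, §V (BPP ⊆ Σ₂ᵖ ∩ Π₂ᵖ, proof)] -/
theorem mem_iff_hashable {L L' : Language Bool} {p : Polynomial ℕ}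
    (hp : ∀ x : List Bool,
      2 / 3 ≤ uniformProb (p.eval x.length) {y : List Bool | boolPair x y ∈ L' ↔ x ∈ L})
    (x : List Bool) :
    x ∈ L ↔ Hashable
      (tuplePow (rejSet ⊤ (ampLang L' p 3) x ((coins p 3).eval x.length))
        (runs ((coins p 3).eval x.length)))
      (runs ((coins p 3).eval x.length) * ((coins p 3).eval x.length - 1)) := by
  set A := ampLang L' p 3 with hA_def
  set m := (coins p 3).eval x.length with hm_def
  have hm : m = 73 * p.eval x.length + 74 := by rw [hm_def, coins_three_eval]
  have hm1 : 1 ≤ m := by omega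
  have hmt : m ≤ runs m := by simp [runs]
  have ht13 : 13 ≤ runs m := by simp only [runs]; omega
  have ht1 : 1 ≤ runs m := le_trans (by norm_num) ht13
  have hrej : (rejSet ⊤ A x m).card = cnt m {y | boolPair x y ∉ A} := card_rejSet_top A x m
  have hquarter : (1 : ℝ) / ((3 : Polynomial ℕ).eval x.length + 1) = 1 / 4 := by norm_num
  by_cases hx : x ∈ L
  · -- YES: the rejecting set is small
    have hset : {y : List Bool | boolPair x y ∈ L' ↔ x ∈ L} = {v | boolPair x v ∈ L'} :=
      Set.ext fun v => by simp [hx]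
    have h23 : 2 / 3 ≤ uniformProb (p.eval x.length) {v | boolPair x v ∈ L'} := by
      have := hp x; rwa [hset] at this
    have hamp := uniformProb_ampLang_compl_le p 3 x h23
    rw [hquarter] at hamp
    have hsmall : 4 * (rejSet ⊤ A x m).card ≤ 2 ^ m := by
      rw [hrej]; exact four_mul_cnt_le hamp
    exact iff_of_true hx (hashable_tuplePow_of_small hm1 ht1 hsmall)
  · -- NO: the rejecting set is large
    have hset : {y : List Bool | boolPair x y ∈ L' ↔ x ∈ L} = {v | boolPair x v ∉ L'} :=
      Set.ext fun v => by simp [hx]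
    have h23 : 2 / 3 ≤ uniformProb (p.eval x.length) {v | boolPair x v ∉ L'} := by
      have := hp x; rwa [hset] at this
    have hamp := uniformProb_ampLang_le p 3 x h23
    rw [hquarter] at hamp
    have hacc : 4 * cnt m {y | boolPair x y ∈ A} ≤ 2 ^ m := four_mul_cnt_le hamp
    have hsum := cnt_add_cnt_compl m {y | boolPair x y ∈ A}
    have hlarge : 3 * 2 ^ m ≤ 4 * (rejSet ⊤ A x m).card := by
      rw [hrej]
      change 3 * 2 ^ m ≤ 4 * cnt m {y | boolPair x y ∈ A}ᶜ
      omega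
    exact iff_of_false hx (not_hashable_tuplePow_of_large hm1 hmt ht13 hlarge)

/-- The level polynomial: `((73p + 79)(73p + 73))(n) = t(m-1)` for `m = 73 p(n) + 74`, `t = m + 5`.
[folklore] -/
theorem level_eval (p : Polynomial ℕ) (n : ℕ) :
    ((73 * p + 79) * (73 * p + 73) : Polynomial ℕ).eval n =
      runs ((coins p 3).eval n) * ((coins p 3).eval n - 1) := by
  have h1 : 73 * p.eval n + 74 - 1 = 73 * p.eval n + 73 := by omega
  rw [coins_three_eval, runs, h1]
  simp

/-- The query map `x ↦ ⟨x, 1^{Q(|x|)}⟩` assembled from the tree's `FP` algebra (`pairFn`, `fstP`,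
`padFn`): its value. [folklore] -/
theorem queryFn_apply (Q : Polynomial ℕ) (x : List Bool) :
    (pairFn fstP (padFn Q) ∘ pairFn id fun _ => ([] : List Bool)) x =
      boolPair x (List.replicate (Q.eval x.length) true) := by
  simp [padFn_apply]

/-- The query map is polynomial-time. [folklore] -/
theorem queryFn_mem_FP (Q : Polynomial ℕ) :
    (pairFn fstP (padFn Q) ∘ pairFn id fun _ => ([] : List Bool)) ∈ FP :=
  comp_mem_FP (pairFn_mem_FP fstP_mem_FP (padFn_mem_FP Q)) (pairFn_mem_FP id_mem_FP (const_mem_FP []))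

end SipserGacs

open SipserGacs

/-- **`BPP ⊆ Σ₂ᵖ`** (Sipser–Gács). For `L ∈ BPP`: amplify to error `1/4`
(`PromiseAmp.ampLang`), express `x ∈ L` as the hashability of the `t`-fold product of the
rejecting coin set by `k = t(m-1)` linear maps (`SipserGacs.mem_iff_hashable`, Sipser's Coding
Lemma), read this off the `Σ₂ᵖ` language `PostBPPHash.Hash` on the query `⟨x, 1^{2k+1}⟩`
(`mem_Hash_iff_rej`), and pull back along the polynomial-time query map (`preimage_mem_SigmaP`).
[cite: Sipser1983, §V (BPP ⊆ Σ₂ᵖ ∩ Π₂ᵖ)] -/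
theorem BPP_subset_SigmaP_two : BPP ⊆ SigmaP 2 := by
  rintro L ⟨L', hL', p, hp⟩
  have hA : ampLang L' p 3 ∈ Classes.P := ampLang_mem_P p 3 hL'
  have hT : (⊤ : Language Bool) ∈ Classes.P := top_mem_P' hA
  have hHash : Hash ⊤ (ampLang L' p 3) (coins p 3) ∈ SigmaP 2 := Hash_mem_SigmaP_two (coins p 3) hT hA
  set Q : Polynomial ℕ := 2 * ((73 * p + 79) * (73 * p + 73)) + 1 with hQ_def
  have hQ : ∀ n, Q.eval n = 2 * (runs ((coins p 3).eval n) * ((coins p 3).eval n - 1)) + 1 := by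
    intro n
    rw [hQ_def, ← level_eval]
    simp
  have hLx : ∀ x : List Bool, x ∈ L ↔
      (pairFn fstP (padFn Q) ∘ pairFn id fun _ => ([] : List Bool)) x ∈
        Hash ⊤ (ampLang L' p 3) (coins p 3) := by
    intro x
    rw [queryFn_apply, hQ, mem_iff_hashable hp x]
    refine (mem_Hash_iff_rej (S := ⊤) (R := ampLang L' p 3) (coins p 3) x _ ?_).symm
    exact lt_of_le_of_lt (Nat.mul_le_mul_left _ (Nat.sub_le _ _)) (Nat.lt_add_of_pos_right (by norm_num))
  have hL : L = (pairFn fstP (padFn Q) ∘ pairFn id fun _ => ([] : List Bool)) ⁻¹'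
      (Hash ⊤ (ampLang L' p 3) (coins p 3)) := Set.ext hLx
  rw [hL]
  exact preimage_mem_SigmaP hHash (queryFn_mem_FP Q)

/-- **`BPP ⊆ Π₂ᵖ`**: `BPP` is closed under complement (`co_BPP_holds`) and `Π₂ᵖ = coΣ₂ᵖ`.
[cite: Sipser1983, §V (BPP ⊆ Σ₂ᵖ ∩ Π₂ᵖ)] -/
theorem BPP_subset_PiP_two : BPP ⊆ PiP 2 := fun L hL => by
  have h1 : Lᶜ ∈ BPP := by
    rw [← co_BPP_holds] at hL
    exact hL
  exact BPP_subset_SigmaP_two h1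

/-- **The Sipser–Gács(–Lautemann) theorem: `BPP ⊆ Σ₂ᵖ ∩ Π₂ᵖ`.** (Sipser 1983, §V, crediting
P. Gács for the level `2`; Lautemann 1983; Arora–Barak 2009, Thm. 7.15.)
[cite: Sipser1983, §V (BPP ⊆ Σ₂ᵖ ∩ Π₂ᵖ)] -/
theorem sipser_gacs_lautemann : BPP ⊆ SigmaP 2 ∩ PiP 2 :=
  fun _ hL => ⟨BPP_subset_SigmaP_two hL, BPP_subset_PiP_two hL⟩

end Literature.Computability.Complexity
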